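import Summits.AtomisticToContinuum.FouriersLaw.Theses.OddSectorIrreversibility
import Literature.Barriers.AtomisticToContinuum.MazurBoundBallisticOpenChain
import Summits.AtomisticToContinuum.FouriersLaw.Theorems.OddSectorIrreversibilityConeScaleCorrectorStubCorrectorSplitting

/-!
# Line `gamblers-ruin-defect` — skeleton for crux `ConeScaleCorrector` (E1)

Crux item `stmt-AtomisticToContinuum-14069`, route `OddSectorIrreversibility` (rank 2):
`∀ ω₂ lam β γ > 0 ∀ T > 0 ∃ C ∀ N ∀ u` (a.e.-limit of the finite-horizon Kubo correctors
`u_τ = ∫₀^τ P_tJ_tot dt` of the equilibrium OPEN chain): `u ∈ L²(μ_T)` and `∫ u² dμ_T ≤ C·N²·Z`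
(`μ_T = e^{-H_N/T} dq dp` unnormalised, `Z` its mass, `P_t = transitionKernel N T T t`).

## The line (idea card `Ideas/gamblers-ruin-defect.md`, re-cut along the triage panel's notes
TRIAGE-r1-1/2/3: "coordinate layer + the honest one-contact odd target"; merged partner card
`Ideas/local-equilibrium-gauge.md`)

Notation (tree objects only): `P = pinnedChain ω₂ lam β γ`; `μ = volume.withDensity e^{-H/T}` (the
crux's `μT`); `Z = ∫ e^{-H/T}`; `Θ(q,p) = (q,-p)`; `w_L(y) = γ(T − p₀²)` the LEFT bath power (the
Ornstein–Uhlenbeck part of the generator applied to `p₀²/2`; `L H = w_L + w_R`,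
`generator_hamiltonian_two_baths`); `E_L := H − X/(N−1)` with `X = OpenChain.energyMoment` the energy
first moment (so `E_L = Σ_k (1 − k/(N−1)) e_k`, the LEFT-EXIT-SHARE = gambler's-ruin / harmonic-measure
weighting of the site energies), `c := ∫E_L dμ / Z`, `Ẽ_L := E_L − c`; `W :=` the a.e.-limit of the
forecasts `W_τ(x) = ∫₀^τ (P_t w_L)(x) dt` ("expected heat drawn from the left bath over the whole future,
given the microstate `x`"); `v := W + Ẽ_L` (the DEFECT); `a := W − W∘Θ` and `b := W + W∘Θ + 2Ẽ_L`,
so that `v = (a + b)/2` identically and — because `E_L` is `Θ`-even (`leftWeightedEnergy_momentumReversal`,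
proved below) — `a = 2v⁻` and `b = 2v⁺` are (twice) the `Θ`-odd and `Θ`-even parts of the defect.

  u  =  (N−1) · v            μ-a.e.                    (stub_correctorSplitting, FIXED N: the generator
                                                        identity L E_L = w_L − J_tot/(N−1) — PROVED,
                                                        FirstLemmaIdeator1.lean `generator_leftWeightedEnergy`
                                                        — + Dynkin for E_L under the constructed kernels
                                                        + CEHR ergodicity P_S E_L → c; W ∈ L²)
  ∫ u² = (N−1)² ∫ v²  ≤  (N−1)² · ½ (∫ a² + ∫ b²)     (pointwise (a+b)²/4 ≤ (a²+b²)/2; `defect_glue`, proved)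
  ∫ a² dμ ≤ C₁ · Z                                     (stub_contactReversalAsymmetry, N-UNIFORM, odd, HARDEST:
                                                        "the reversal asymmetry of the lifetime left-contact
                                                        heat forecast is intensive" ⟺ ‖u − u∘Θ‖² ≤ C₁(N−1)²Z,
                                                        the route's corrected namesake WSI′ — exactly what the
                                                        route's WitnessGlue consumes)
  ∫ b² dμ ≤ C₂ · Z                                     (stub_evenForecastLocalEquilibrium, N-UNIFORM, even:
                                                        "the reversal-symmetrised left-contact heat forecast IS
                                                        minus the left-exit-share-weighted energy excess, up to
                                                        an intensive L² error" — first-order local equilibrium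
                                                        of the even sector; needed for E1 AS TYPED only)
  ⟹ ∫ u² ≤ ½(C₁ + C₂) · N² · Z.

`N ≤ 1`: `J_tot ≡ 0 ⇒ u = 0` a.e. (`slice_le_one`, proved; = Disproof.lean §1
`coneScaleCorrector_slice_le_one`, re-proved here because crux workfiles are not importable).

## Why this cut (answers to the triage panel)
* TRIAGE-r1-1/r1-2 ("costume: `ContactDefectBound` = E1/(N−1)²; `v` is NOT cancellation-free"): accepted.
  `ContactDefectBound` is NOT a stub of this line.  The `N`-uniform content is cut by PARITY into two
  named statements of different physical type, each strictly weaker than E1 and neither an E1-equivalent: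
  the odd one is the one-contact form of WSI′ that r1-1 names as "the honest cancellation-free one-contact
  target (O)", the even one is the local-equilibrium statement proper (temperature-profile / Kapitza /
  resistance-fluctuation sector, TRIAGE-r1-3 (F4)).  The claim "cancellation-free" is dropped from the
  card (r1-3 sharpen); what the contact coordinates buy is stated per stub below (one-site Θ-even source
  `w_L`, pathwise estimator `Q_tot/(N−1) = Q_L − ΔE_L`, exposure to the contact/exit-law toolkits).
* TRIAGE-r1-3 / all three seats (tenure remark): the route's `closes` uses E1 only through `‖u⁻‖ ≤ ‖u‖`;
  here `‖u⁻‖² = (N−1)²·¼∫a²`, so `stub_contactReversalAsymmetry` ALONE carries what the assembly needs and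
  `stub_evenForecastLocalEquilibrium` is flagged "for E1 as typed" — the lead / tenure planner can act on it.
* Relation to the partner line (local-equilibrium-gauge, Halving): with `M₁ = ∫₀^∞ t⟨J, P_tJ⟩_{μ} dt`,
  `−M₁ = ‖u⁺‖² − ‖u⁻‖² = (N−1)²·¼(∫b² − ∫a²)`; so `FirstMomentLower ⟸ stub_evenForecastLocalEquilibrium`
  and, given the odd stub, they are equivalent.  This line keeps the DIRECT even bound (an explicit `L²`
  functional, statically comparable to the linear-profile LE state) and needs no detailed-balance identity
  in its glue; the lead may swap in Halving + FirstMomentLower without touching the other two stubs.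

## Mechanics
* Registered stubs = the three `theorem stub_… := by sorry` below; their signatures are self-contained
  over TREE declarations only (`pinnedChain`, `OscillatorChain.hamiltonian/bondCurrent/transitionKernel`,
  `OpenChain.energyMoment`, Mathlib), written in the crux's own raw vocabulary (`volume.withDensity e^{-H/T}`,
  `∫₀^τ ∫ f d(transitionKernel N T T t x) dt`), so a landed `--supports` proof can restate them verbatim.
  `sorry` occurs nowhere else.
* `ConeScaleCorrector_of : ConeScaleCorrector` concludes the crux decl BY NAME; its body is the complete
  composition (`defect_glue` + `slice_le_one`, both proved, standard axioms) calling the three stubs through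
  `have h := stub_…` — turn those three `have`s into hypotheses to re-abstract the composition.
* Also PROVED here (standard axioms; not obligations, hence `tree.orphan` in the advisory audit — harmless
  in a Lines file): `leftWeightedEnergy_momentumReversal` (`E_L∘Θ = E_L`), `ae_comp_momentumReversal`
  (`μ_T`-a.e. statements transport along `Θ` — infrastructure for the parity stubs' provers) and
  `oddHalf_of_line`: stubs 1 + 2 ALONE give the odd half of E1, `∫(u − u∘Θ)² dμ_T ≤ C·N²·Z` with its
  `MemLp`, in the crux's raw vocabulary — the 2-stub skeleton of the weakened crux the triage seats propose.
* Disproof.lean (cdisprove cycle 1) honoured: §2a `coneScaleCorrector_false_without_correctorHyp` — the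
  corrector predicate is USED (it is the hypothesis of stub_correctorSplitting, which is where `L u = −J`
  enters; the two N-uniform stubs quantify over `W` only under ITS corrector predicate + `MemLp`);
  §2b `coneScaleCorrector_false_without_anharmonicity_of` — `0 < lam, 0 < β` are hypotheses of every stub and
  are load-bearing in BOTH N-uniform stubs (harmonic RLL member: `∫a², ∫b² ≍ N·Z`, odd:even ≈ 3:2, the
  card's exact Gaussian table `‖v‖²_π = 0.126·N`), while stub_correctorSplitting holds verbatim at
  `lam = β = 0` (checked there to 1e-14, card §Cheapest falsifier (1)); §3 GK floor respected
  (`∫v²/Z ≥ T⁴D_N²/(KN) → 0`, no tension with O(1)); §4 `coneScaleCorrectorLinear_false_of_coneFloor` — no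
  stub is at scale `N¹` for `u` (i.e. none claims `∫a²` or `∫b² = O(Z/N)`); §5 `echo_identity` — `∫a²` is
  the contact form of the echo norm `‖u − uΘ‖²`.  `-- Targets: none yet`; no Negative lemma has landed
  for this crux (Theorems/ConeScaleCorrector/ does not exist), so no stub can instance one; the neighbours'
  landed negatives are respected: FalseOfLocality (no `∫‖P_t·‖dt` of an extensive vector anywhere here),
  EchoFloor/OddPairing for 9140 (lower bound `cN² ≤ ‖u − uΘ‖²` is the matching floor of the odd stub's
  `C₁(N−1)²`, consistent).
-/

namespace Summit.AtomisticToContinuum.FouriersLaw.Cruxes.ConeScaleCorrector.GamblersRuinDefect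

open MeasureTheory Filter Topology
open scoped ENNReal NNReal BigOperators
open Literature.MathematicalPhysics.KineticTheory.HeatConduction
open Literature.Barriers.AtomisticToContinuum.OpenChain
open Summit.AtomisticToContinuum.FouriersLaw.Theses.OddSectorIrreversibility

noncomputable section

/-! ## The three REGISTERED stubs (`theorem stub_… := by sorry`; `sorry` occurs nowhere else) -/

/-- **stub_correctorSplitting** — CLOSED: LANDED p90636 (`Theorems/OddSectorIrreversibilityConeScaleCorrectorStubCorrectorSplitting.lean`, lead). (FIXED `N ≥ 2`; size M–L; the card's exact identity layer
`u = (N−1)·v`, `v = W + Ẽ_L`).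
For all parameters `> 0`, `T > 0`, `N ≥ 2` and every `u` satisfying the crux's corrector predicate
(a.e.-limit of `∫₀^τ P_tJ_tot dt`, VERBATIM the crux antecedent): there is `W ∈ L²(μ)`, an a.e.-limit of
the forecasts `∫₀^τ P_t w_L dt` of the one-site, `Θ`-even left bath power `w_L = γ(T − p₀²)` (written as a
sum over `i = 0`), such that `u = (N−1)·(W + E_L − c)` `μ`-a.e., `E_L = H − X/(N−1)`, `c = ∫E_L dμ/Z`.
Truth behind it (what the prover shows, all fixed-`N`): (i) the generator identity
`L E_L = w_L − J_tot/(N−1)` — PROVED (`Cruxes/ConeScaleCorrector/FirstLemmaIdeator1.lean`,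
`generator_leftWeightedEnergy`, rc 0, std axioms; its `leftWeightedEnergy` is this `E_L` by
`leftWeightedEnergy_eq`; the `w_k = 1 − k/(N−1)` instance of `poisson_hamiltonian_weightedEnergy` +
`generator_eq_poisson_add_taps`: `∂_{p_{N−1}}E_L = 0`, `∂_{p₀}E_L = p₀`, so the right tap is invisible and
the left tap gives `w_L`); (ii) DYNKIN for the polynomially bounded `E_L` (`|E_L| ≤ 3H`) under the
constructed kernels: `P_S E_L(x) − E_L(x) = ∫₀^S P_t(L E_L)(x) dt = W_S(x) − u_S(x)/(N−1)` for every `x`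
(truncation route of `Theorems/…SubdiffusiveBondHeatSiteEnergyDynkin` / `pinnedChain_dynkin_of_truncation`,
`generator_mul_smoothCutoff_hamiltonian`, CEHR (3.4) moment bounds); (iii) `P_S E_L(x) → π(E_L) = c` for
EVERY `x` as `S → ∞` (`pinnedChainSemigroup_ergodic`, PROVED: weighted exponential convergence for
continuous `|f| ≤ e^{ϑH}`, `ϑ < 1/T`; `μ/Z` is the invariant probability by
`pinnedChain_isSteadyState_gibbsMeasure` + uniqueness); hence `W := lim W_S` exists wherever `lim u_S`
does and `W = u/(N−1) − Ẽ_L` a.e.; (iv) `W ∈ L²(μ)`: `|W_S(x)| ≤ ∫₀^∞|P_t w̃_L|(x)dt ≤ (C/c)e^{ϑH(x)}` with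
`2ϑ < 1/T` (same ergodic bound), and `e^{2ϑH} ∈ L¹(μ)` (`pinnedChain_integrable_exp_mul_gibbsDensity`).
Holds verbatim at `lam = β = 0` (exact Gaussian check of the card, split-err ≤ 3e-14, N = 3…10) — the
anharmonicity hypotheses are kept only to match the crux's parameter range.
Pathwise content (the estimator for every replica numeric downstream): `E_L(X_t) − E_L(X_0) − Q_L(t)
= −Q_tot(t)/(N−1)` trajectory by trajectory (`Q_L` = energy absorbed from the left bath incl. noise work).
Leans on: generator_leftWeightedEnergy (crux workfile, to be re-landed under Theorems/ with this stub),
sum_bondCurrent_eq_poisson, pinnedChain_generator_energyMoment, generator_hamiltonian_two_baths,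
pinnedChain_transitionKernel_add/_apply, pinnedChain_integral_transitionKernel, pinnedChain_dynkin,
pinnedChainSemigroup_ergodic, pinnedChain_isSteadyState_gibbsMeasure, pinnedChain_integrable_exp_mul_gibbsDensity,
Mathlib `MeasureTheory.MemLp`, `intervalIntegral`/`setIntegral` API, `tendsto_nhds_unique`. -/
theorem stub_correctorSplitting :
    ∀ ω₂ lam β γ : ℝ, 0 < ω₂ → 0 < lam → 0 < β → 0 < γ → ∀ T : ℝ, 0 < T → ∀ N : ℕ, 2 ≤ N →
    ∀ u : PhaseSpace N → ℝ,
    (∀ᵐ x ∂(volume.withDensity fun x : PhaseSpace N =>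
        ENNReal.ofReal (Real.exp (-((pinnedChain ω₂ lam β γ).hamiltonian N x) / T))),
      Tendsto (fun τ : ℝ => ∫ t in Set.Ioc (0 : ℝ) τ,
          ∫ y, (∑ i : Fin N, (pinnedChain ω₂ lam β γ).bondCurrent N i y)
            ∂((pinnedChain ω₂ lam β γ).transitionKernel N T T t.toNNReal x)) atTop (𝓝 (u x))) →
    ∃ W : PhaseSpace N → ℝ,
      MemLp W 2 (volume.withDensity fun x : PhaseSpace N =>
        ENNReal.ofReal (Real.exp (-((pinnedChain ω₂ lam β γ).hamiltonian N x) / T))) ∧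
      (∀ᵐ x ∂(volume.withDensity fun x : PhaseSpace N =>
          ENNReal.ofReal (Real.exp (-((pinnedChain ω₂ lam β γ).hamiltonian N x) / T))),
        Tendsto (fun τ : ℝ => ∫ t in Set.Ioc (0 : ℝ) τ,
            ∫ y, (∑ i : Fin N, if i.val = 0 then γ * (T - y.2 i ^ 2) else 0)
              ∂((pinnedChain ω₂ lam β γ).transitionKernel N T T t.toNNReal x)) atTop (𝓝 (W x))) ∧
      (∀ᵐ x ∂(volume.withDensity fun x : PhaseSpace N =>
          ENNReal.ofReal (Real.exp (-((pinnedChain ω₂ lam β γ).hamiltonian N x) / T))),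
        u x = ((N : ℝ) - 1) * (W x +
          (((pinnedChain ω₂ lam β γ).hamiltonian N x
              - energyMoment (pinnedChain ω₂ lam β γ) N x / ((N : ℝ) - 1))
            - (∫ y, ((pinnedChain ω₂ lam β γ).hamiltonian N y
                  - energyMoment (pinnedChain ω₂ lam β γ) N y / ((N : ℝ) - 1))
                ∂(volume.withDensity fun x : PhaseSpace N =>
                    ENNReal.ofReal (Real.exp (-((pinnedChain ω₂ lam β γ).hamiltonian N x) / T))))
              / (∫ y : PhaseSpace N, Real.exp (-((pinnedChain ω₂ lam β γ).hamiltonian N y) / T))))) :=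
  Summit.AtomisticToContinuum.FouriersLaw.Theorems.OddSectorIrreversibility.stub_correctorSplitting

/-- **stub_generatorLeftEnergy** — CLOSED: LANDED p86917. (FIXED `N ≥ 2`; size S–M; pure calculus; registered sub-stub of
`stub_correctorSplitting`, lead reshape 2026-08-16). The generator identity `L E_L = w_L − J_tot/(N−1)` for
`E_L = H − X/(N−1)` (`X = energyMoment`), `w_L = γ(T − p₀²)` written as a sum over `i = 0`, at equal bath
temperatures and for EVERY real parameter value (no positivity needed). PROVED in the crux workfile
`Cruxes/ConeScaleCorrector/FirstLemmaIdeator1.lean` (`generator_leftWeightedEnergy`, via `leftWeightedEnergy_eq :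
leftWeightedEnergy = H − X/(N−1)`, `generator_eq_poisson_add_taps`, `poisson_self`, `sum_bondCurrent_eq_poisson`,
`partialP_hamiltonian`, `partialP_energyMoment`); to be re-landed under `Theorems/` (crux workfiles are not importable). -/
theorem stub_generatorLeftEnergy :
    ∀ ω₂ lam β γ T : ℝ, ∀ N : ℕ, 2 ≤ N → ∀ x : PhaseSpace N,
    (pinnedChain ω₂ lam β γ).generator N T T
        (fun y : PhaseSpace N => (pinnedChain ω₂ lam β γ).hamiltonian N y
          - energyMoment (pinnedChain ω₂ lam β γ) N y / ((N : ℝ) - 1)) x =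
      (∑ i : Fin N, if i.val = 0 then γ * (T - x.2 i ^ 2) else 0)
        - (1 / ((N : ℝ) - 1)) * ∑ i : Fin N, (pinnedChain ω₂ lam β γ).bondCurrent N i x :=
  Summit.AtomisticToContinuum.FouriersLaw.Theorems.OddSectorIrreversibility.stub_generatorLeftEnergy

/-- **stub_dynkinLeftEnergy** — CLOSED: LANDED p89796 (+Aux p88838). (FIXED `N ≥ 2`; size M; registered sub-stub of `stub_correctorSplitting`, lead reshape
2026-08-16). DYNKIN'S IDENTITY for the polynomially bounded observable `E_L = H − X/(N−1)` under the CONSTRUCTED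
equilibrium kernels: `P_r E_L(z) − E_L(z) = ∫₀ʳ P_s(L E_L)(z) ds` for all `r ≥ 0`, `z`, with `L E_L` written as
`generator N T T E_L` (so this stub is independent of `stub_generatorLeftEnergy`). Route: truncations `E_L · χ(H/R)`
(`smoothCutoff`), `generator_mul_smoothCutoff_hamiltonian` + the pattern of `pinnedChain_abs_generator_truncSiteEnergy_sub_le`
(`|E_L| ≤ 2H`, `∂_{p₀}E_L = p₀`, `∂_{p_{N−1}}E_L = 0`, `|L E_L| ≤ B(1+H)²`), then `pinnedChain_dynkin_of_truncation`
(Theorems/BondHeatUncertaintySubdiffusiveBondHeatSiteEnergyDynkinTruncation.lean; CEHR (3.4) moment bounds). -/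
theorem stub_dynkinLeftEnergy :
    ∀ ω₂ lam β γ : ℝ, 0 < ω₂ → 0 < lam → 0 < β → 0 < γ → ∀ T : ℝ, 0 < T → ∀ N : ℕ, 2 ≤ N →
    ∀ (r : NNReal) (z : PhaseSpace N),
    (∫ y, ((pinnedChain ω₂ lam β γ).hamiltonian N y
          - energyMoment (pinnedChain ω₂ lam β γ) N y / ((N : ℝ) - 1))
        ∂((pinnedChain ω₂ lam β γ).transitionKernel N T T r z))
      - ((pinnedChain ω₂ lam β γ).hamiltonian N z - energyMoment (pinnedChain ω₂ lam β γ) N z / ((N : ℝ) - 1)) =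
    ∫ s in (0 : ℝ)..(r : ℝ),
      ∫ y, (pinnedChain ω₂ lam β γ).generator N T T
          (fun y' : PhaseSpace N => (pinnedChain ω₂ lam β γ).hamiltonian N y'
            - energyMoment (pinnedChain ω₂ lam β γ) N y' / ((N : ℝ) - 1)) y
        ∂((pinnedChain ω₂ lam β γ).transitionKernel N T T s.toNNReal z) :=
  Summit.AtomisticToContinuum.FouriersLaw.Theorems.OddSectorIrreversibility.stub_dynkinLeftEnergy

/-- **stub_contactReversalAsymmetry** (N-UNIFORM; the Θ-ODD half; the line's HARDEST stub; size XL —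
an ergodic-type statement on a deterministic anharmonic bulk, nothing of the kind is proved for any
FPU/φ⁴ chain).  For all parameters `> 0` and `T > 0` there is `C` with: for every `N ≥ 2` and every
`W ∈ L²(μ)` that is an a.e.-limit of the left-bath-power forecasts `∫₀^τ P_t w_L dt`,
`W − W∘Θ ∈ L²(μ)` and `∫ (W(x) − W(Θx))² dμ ≤ C·Z`:
the REVERSAL ASYMMETRY of the lifetime left-contact heat forecast — "how much more heat the left bath
expects to supply to the microstate `x` than to its momentum reversal `Θx`" — is INTENSIVE in `L²(Gibbs)`.
Dictionary: `Ẽ_L∘Θ = Ẽ_L` (proved below), so `u − u∘Θ = (N−1)(W − W∘Θ)` a.e. by stub_correctorSplitting;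
the stub is therefore EXACTLY the odd half of E1, `‖u − u∘Θ‖²_{μ} ≤ C(N−1)²Z` = the route's corrected
namesake WSI′ / card local-equilibrium-gauge's `OddConeForecast` (`sup_N ∫(h − h∘Θ)²dπ < ∞` through
`OddDensityIsCorrector`), in ONE-CONTACT form (TRIAGE-r1-1's "(O)").  It is what `WitnessGlue` consumes
(`‖u⁻‖ ≤ ‖u‖`).  Why plausible (the route's cone heuristic, Disproof §5): `(u − uΘ)(x) = E[∫_ℝ J_tot(X_t)dt |
X_0 = x]` is the two-sided transport of the causal window `|t| ≲ N/v_B`, of variance `≍ σ²N·N/v_B`, and the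
bet of E1 is that nothing more survives the scrambling by boundary noise + bulk chaos; divided by `(N−1)²`
this is `O(1)`: per unit length, a microstate and its reversal differ in expected lifetime left-bath heat
by an `O(1)` amount in `L²`.  Why it might fail: forecastable transport persisting over a number of causal
crossings that GROWS with `N` (weak chaos / sticky breathers / KAM islands at low `T·lam`; harmonic band
edge: RLL `∫a² ≍ N·Z`, odd:even ≈ 3:2 of `‖u‖² ≍ N³` — FALSE at `lam = β = 0`, Disproof §2b honoured);
`C(T) ≈ σ²a/4 + O(1)` blows up in the cold / near-harmonic corner (admissible pointwise in `T`;
quasi-ballistic pre-asymptotics at `(1,1,1,1), T = 1`, `N ≲ 64`, rattack-14069 caveat).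
What the contact form exposes (card, why-it-bites (2)/(b), kept at the triage's valuation "real but weak"):
the source `w_L` is a one-site, `Θ`-even, Hermite-2 observable of the thermostatted momentum
(`⟨w_L, G⟩_π = −γT²⟨∂²_{p₀}G⟩_π`), so the stub is a statement about ONE contact's exit statistics
(toolkits of BoundaryEscapeDeficit / GriffithsLimitExchange / KineticSlabContacts / BoundaryKubo), and the
iso-noise Girsanov reparametrisation gives the rigorous N-uniform TRANSIENT budget
`‖∫₀^S P_t w_L dt‖²_{L²(π)} ≤ γT²S/2` (controls `S = O(1)` only).  Numerical signature: replica estimate of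
`∫(W_S − W_S∘Θ)²/Z` at `S ≳ 2N` must plateau in `N` at the diffusive point `(1,1,0.1,1), T = 8`
(= `a_N·T⁴·(N/(N−1))²`-type quantity; `a_N = 0.14/0.40/0.75` at `N = 8/16/32` measured on 9140 is
`N∫(h−hΘ)²`, i.e. `∫(h−hΘ)² = O(1/N)…O(1)` — consistent so far).
Leans on: nothing N-uniform in tree; fixed-N vocabulary as in stub_correctorSplitting;
measurePreserving_momentumReversal, hamiltonian_neg_momentum, bondCurrent_neg_momentum (LangevinChainGibbs);
KunduDharNarayan2009 (reln2) `L† = ΘLΘ`; CuneoEckmannHairerReyBellet2018 Thm 2.13. -/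
theorem stub_contactReversalAsymmetry :
    ∀ ω₂ lam β γ : ℝ, 0 < ω₂ → 0 < lam → 0 < β → 0 < γ → ∀ T : ℝ, 0 < T → ∃ C : ℝ, ∀ N : ℕ, 2 ≤ N →
    ∀ W : PhaseSpace N → ℝ,
    MemLp W 2 (volume.withDensity fun x : PhaseSpace N =>
      ENNReal.ofReal (Real.exp (-((pinnedChain ω₂ lam β γ).hamiltonian N x) / T))) →
    (∀ᵐ x ∂(volume.withDensity fun x : PhaseSpace N =>
        ENNReal.ofReal (Real.exp (-((pinnedChain ω₂ lam β γ).hamiltonian N x) / T))),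
      Tendsto (fun τ : ℝ => ∫ t in Set.Ioc (0 : ℝ) τ,
          ∫ y, (∑ i : Fin N, if i.val = 0 then γ * (T - y.2 i ^ 2) else 0)
            ∂((pinnedChain ω₂ lam β γ).transitionKernel N T T t.toNNReal x)) atTop (𝓝 (W x))) →
    MemLp (fun x : PhaseSpace N => W x - W (x.1, -x.2)) 2 (volume.withDensity fun x : PhaseSpace N =>
      ENNReal.ofReal (Real.exp (-((pinnedChain ω₂ lam β γ).hamiltonian N x) / T))) ∧
    ∫ x, (W x - W (x.1, -x.2)) ^ 2 ∂(volume.withDensity fun x : PhaseSpace N =>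
        ENNReal.ofReal (Real.exp (-((pinnedChain ω₂ lam β γ).hamiltonian N x) / T)))
      ≤ C * ∫ x : PhaseSpace N, Real.exp (-((pinnedChain ω₂ lam β γ).hamiltonian N x) / T) := by
  sorry

/-- **stub_evenForecastLocalEquilibrium** (N-UNIFORM; the Θ-EVEN half; size XL; needed for E1 AS TYPED —
the route's `closes` consumes only the odd half).  For all parameters `> 0` and `T > 0` there is `C` with:
for every `N ≥ 2` and every `W ∈ L²(μ)` that is an a.e.-limit of the left-bath-power forecasts,
`b := W + W∘Θ + 2Ẽ_L ∈ L²(μ)` and `∫ b² dμ ≤ C·Z`, `Ẽ_L = E_L − ∫E_L dμ/Z`, `E_L = H − X/(N−1)`.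
Since `Ẽ_L` is `Θ`-even, `b/2 = v⁺ = ½(W + W∘Θ) + Ẽ_L`: the REVERSAL-SYMMETRISED lifetime left-contact
heat forecast equals MINUS the left-exit-share-weighted energy excess `−Σ_k (1 − k/(N−1)) ẽ_k`
(gambler's-ruin law: an energy excess at site `k` leaves through the LEFT bath with the harmonic-measure
probability `1 − k/(N−1)`), up to an error that is INTENSIVE in `L²(Gibbs)` — first-order LOCAL
EQUILIBRIUM of the even sector.  Static (NESS) face, card local-equilibrium-gauge / this card face (c):
`v = −T²(h − h^{LE})∘Θ` with `h` the linear-response density of `μ_{N,T+δ/2,T−δ/2}` and `h^{LE}` the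
density of the LINEAR-profile local Gibbs state, so the stub reads `‖h⁺ − h^{LE}‖_{L²(π)} = O(1)`:
the even part of the first-order NESS correction to linear-profile LE is intensive (temperature profile
linear up to ℓ²-summable Kapitza layers; linear-order energy–energy pair correlations `O(1/N)` per pair in
ℓ²).  Dictionary to the partner line: `∫b² = 4‖v⁺‖² = 4‖u⁺‖²/(N−1)²`, and with the first Green–Kubo
time-moment `M₁ = ∫₀^∞ t⟨J,P_tJ⟩_μ dt` one has `−M₁ = ‖u⁺‖² − ‖u⁻‖²`; hence this stub implies
`FirstMomentLower` (`−M₁ ≤ C′N²Z`) and is equivalent to it given stub_contactReversalAsymmetry.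
Why plausible: after the causal window has passed, the forecast of the remaining heat release is a
functional of the energy PROFILE booked by its exit shares; the linear (one-point) part is exactly `−Ẽ_L`
up to Kapitza corrections `δ·O(ℓ_K/N)·(k−c)/N` contributing `O(ℓ_K²/N) → 0` to `∫b²/Z`; what survives at
`O(1)` is the `(1/(N−1))`-weighted in-window reshuffling (`≈ σ²a/4`), the future-minus-past cone asymmetry,
and the QUADRATIC resistance-fluctuation functional `Σ K(k,l)ẽ_kẽ_l/(N−1)`, `K = (r′/r)(1_{l<k} − k/(N−1))
= O(1)` (TRIAGE-r1-3 (F4): `‖·‖² ≍ N²·Z` in `u`-units, i.e. AT this stub's scale — the stub is tight, not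
slack).  Why it might fail: a flat / S-shaped first-order temperature profile (ballistic or anomalous
transport: RLL `∫b² ≍ N·Z` — FALSE at `lam = β = 0`, Disproof §2b honoured), Kapitza layers whose width
grows with `N`, or linear-order long-range pair correlations stronger than `1/N` (resistance correlations
with a divergent kernel; would be news for a pinned chain); `C(T)` blows up in the cold corner.
NECESSARY tests it exposes (partner card, cheap falsifiers — they can kill, not prove): one-point profile
defect `S₁(N) = Σ_kΔ_k²` bounded; pair-defect `Σ_{k,l}Δ_{kl}²` bounded; both from ±δ NEMD profiles or
equilibrium FDT runs at `(1,1,0.1,1), T = 8`, `N = 16…128`.  Cross-route suppliers of its linear part: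
LocalOhmBV / AffineAnchor / ProfileLadder (any N-uniform local-Ohm statement with ℓ² boundary layers).
Leans on: fixed-N vocabulary as above; BrascampLieb1976_thm41_uniform(_holds) (statics of `ẽ_k`, `Ẽ_L`,
frame bounds, uniformly in `N`); AokiKusnezov2001/2002 (Kapitza jumps; LE violations ∝ (∇T)²), Dhar2008,
BonettoLebowitzReyBellet2000 §6, BertiniEtAl2015 (size of non-equilibrium long-range correlations),
LefevereSchenkel2006 / BricmontKupiainen2007 (the even sector in print: closures for NESS pair correlations
of pinned anharmonic chains). -/
theorem stub_evenForecastLocalEquilibrium :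
    ∀ ω₂ lam β γ : ℝ, 0 < ω₂ → 0 < lam → 0 < β → 0 < γ → ∀ T : ℝ, 0 < T → ∃ C : ℝ, ∀ N : ℕ, 2 ≤ N →
    ∀ W : PhaseSpace N → ℝ,
    MemLp W 2 (volume.withDensity fun x : PhaseSpace N =>
      ENNReal.ofReal (Real.exp (-((pinnedChain ω₂ lam β γ).hamiltonian N x) / T))) →
    (∀ᵐ x ∂(volume.withDensity fun x : PhaseSpace N =>
        ENNReal.ofReal (Real.exp (-((pinnedChain ω₂ lam β γ).hamiltonian N x) / T))),
      Tendsto (fun τ : ℝ => ∫ t in Set.Ioc (0 : ℝ) τ,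
          ∫ y, (∑ i : Fin N, if i.val = 0 then γ * (T - y.2 i ^ 2) else 0)
            ∂((pinnedChain ω₂ lam β γ).transitionKernel N T T t.toNNReal x)) atTop (𝓝 (W x))) →
    MemLp (fun x : PhaseSpace N => W x + W (x.1, -x.2) + 2 *
        ((((pinnedChain ω₂ lam β γ).hamiltonian N x
              - energyMoment (pinnedChain ω₂ lam β γ) N x / ((N : ℝ) - 1))
            - (∫ y, ((pinnedChain ω₂ lam β γ).hamiltonian N y
                  - energyMoment (pinnedChain ω₂ lam β γ) N y / ((N : ℝ) - 1))
                ∂(volume.withDensity fun x : PhaseSpace N =>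
                    ENNReal.ofReal (Real.exp (-((pinnedChain ω₂ lam β γ).hamiltonian N x) / T))))
              / (∫ y : PhaseSpace N, Real.exp (-((pinnedChain ω₂ lam β γ).hamiltonian N y) / T)))))
      2 (volume.withDensity fun x : PhaseSpace N =>
        ENNReal.ofReal (Real.exp (-((pinnedChain ω₂ lam β γ).hamiltonian N x) / T))) ∧
    ∫ x, (W x + W (x.1, -x.2) + 2 *
        ((((pinnedChain ω₂ lam β γ).hamiltonian N x
              - energyMoment (pinnedChain ω₂ lam β γ) N x / ((N : ℝ) - 1))
            - (∫ y, ((pinnedChain ω₂ lam β γ).hamiltonian N y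
                  - energyMoment (pinnedChain ω₂ lam β γ) N y / ((N : ℝ) - 1))
                ∂(volume.withDensity fun x : PhaseSpace N =>
                    ENNReal.ofReal (Real.exp (-((pinnedChain ω₂ lam β γ).hamiltonian N x) / T))))
              / (∫ y : PhaseSpace N, Real.exp (-((pinnedChain ω₂ lam β γ).hamiltonian N y) / T))))) ^ 2
      ∂(volume.withDensity fun x : PhaseSpace N =>
        ENNReal.ofReal (Real.exp (-((pinnedChain ω₂ lam β γ).hamiltonian N x) / T)))
      ≤ C * ∫ x : PhaseSpace N, Real.exp (-((pinnedChain ω₂ lam β γ).hamiltonian N x) / T) := by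
  sorry

/-! ## Proved glue lemmas (no `sorry` below this line) -/

/-- The gambler's-ruin-weighted energy `E_L = H − X/(N−1)` is even under momentum reversal (so that
`a = W − W∘Θ` and `b = W + W∘Θ + 2Ẽ_L` are twice the `Θ`-odd / `Θ`-even parts of the defect `v = W + Ẽ_L`).
Documentation lemma; the composition below does not need it. -/
theorem leftWeightedEnergy_momentumReversal (P : OscillatorChain) (N : ℕ) (x : PhaseSpace N) :
    P.hamiltonian N (x.1, -x.2) - energyMoment P N (x.1, -x.2) / ((N : ℝ) - 1) =
      P.hamiltonian N x - energyMoment P N x / ((N : ℝ) - 1) := by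
  rw [OscillatorChain.hamiltonian_neg_momentum]
  congr 2
  simp [energyMoment]

/-- For `N ≤ 1` there is no bond: every bond current vanishes identically. -/
theorem bondCurrent_eq_zero_of_le_one (P : OscillatorChain) {N : ℕ} (hN : N ≤ 1) (i : Fin N)
    (z : PhaseSpace N) : P.bondCurrent N i z = 0 := by
  unfold OscillatorChain.bondCurrent
  refine Finset.sum_eq_zero fun j _ => ?_
  have hi := i.isLt
  have hj := j.isLt
  rw [if_neg (by omega)]

/-- **`μ_T`-a.e. statements transport along `Θ(q,p) = (q,−p)`**: the Gibbs weight has an everywhere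
positive continuous density w.r.t. Lebesgue measure (`ae μ_T = ae volume`), and `Θ` preserves Lebesgue
measure (`measurePreserving_momentumReversal`).  Infrastructure for the provers of the two parity stubs. -/
theorem ae_comp_momentumReversal {ω₂ lam β γ T : ℝ} {N : ℕ} {p : PhaseSpace N → Prop}
    (h : ∀ᵐ x ∂(volume.withDensity fun x : PhaseSpace N =>
        ENNReal.ofReal (Real.exp (-((pinnedChain ω₂ lam β γ).hamiltonian N x) / T))), p x) :
    ∀ᵐ x ∂(volume.withDensity fun x : PhaseSpace N =>
        ENNReal.ofReal (Real.exp (-((pinnedChain ω₂ lam β γ).hamiltonian N x) / T))), p (x.1, -x.2) := by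
  have hmeas : Measurable fun x : PhaseSpace N =>
      ENNReal.ofReal (Real.exp (-((pinnedChain ω₂ lam β γ).hamiltonian N x) / T)) :=
    (pinnedChain_continuous_gibbsDensity ω₂ lam β γ N T).measurable.ennreal_ofReal
  have hne : ∀ x : PhaseSpace N,
      ENNReal.ofReal (Real.exp (-((pinnedChain ω₂ lam β γ).hamiltonian N x) / T)) ≠ 0 := fun x h0 =>
    absurd (ENNReal.ofReal_eq_zero.1 h0) (not_le.2 (Real.exp_pos _))
  rw [ae_withDensity_iff hmeas] at h ⊢
  have hvol : ∀ᵐ x ∂(volume : Measure (PhaseSpace N)), p x := h.mono fun x hx => hx (hne x)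
  have hΘ := (measurePreserving_momentumReversal N).quasiMeasurePreserving.ae hvol
  filter_upwards [hΘ] with x hx _
  simpa only [momentumReversal_apply] using hx

/-- For `N ≤ 1` the corrector predicate forces `u = 0` a.e. (`J_tot ≡ 0`). -/
theorem corrector_ae_eq_zero_of_le_one {ω₂ lam β γ T : ℝ} {N : ℕ} (hN : N ≤ 1)
    (u : PhaseSpace N → ℝ)
    (hu : ∀ᵐ x ∂(volume.withDensity fun x : PhaseSpace N =>
        ENNReal.ofReal (Real.exp (-((pinnedChain ω₂ lam β γ).hamiltonian N x) / T))),
      Tendsto (fun τ : ℝ => ∫ t in Set.Ioc (0 : ℝ) τ,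
          ∫ y, (∑ i : Fin N, (pinnedChain ω₂ lam β γ).bondCurrent N i y)
            ∂((pinnedChain ω₂ lam β γ).transitionKernel N T T t.toNNReal x)) atTop (𝓝 (u x))) :
    u =ᵐ[volume.withDensity fun x : PhaseSpace N =>
      ENNReal.ofReal (Real.exp (-((pinnedChain ω₂ lam β γ).hamiltonian N x) / T))] 0 := by
  filter_upwards [hu] with x hx
  have hx' : Tendsto (fun _ : ℝ => (0 : ℝ)) atTop (𝓝 (u x)) :=
    hx.congr fun τ => by simp [bondCurrent_eq_zero_of_le_one (pinnedChain ω₂ lam β γ) hN]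
  exact tendsto_nhds_unique hx' tendsto_const_nhds

/-- **Degenerate slice `N ≤ 1`** (= Disproof.lean §1 `coneScaleCorrector_slice_le_one`, re-proved in the
crux's raw vocabulary): `J_tot ≡ 0`, so the corrector predicate forces `u = 0` a.e. and the `N`-instance
of E1 holds for every constant `K ≥ 0`. -/
theorem slice_le_one {ω₂ lam β γ T : ℝ} {N : ℕ} (hN : N ≤ 1) {K : ℝ} (hK : 0 ≤ K)
    (u : PhaseSpace N → ℝ)
    (hu : ∀ᵐ x ∂(volume.withDensity fun x : PhaseSpace N =>
        ENNReal.ofReal (Real.exp (-((pinnedChain ω₂ lam β γ).hamiltonian N x) / T))),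
      Tendsto (fun τ : ℝ => ∫ t in Set.Ioc (0 : ℝ) τ,
          ∫ y, (∑ i : Fin N, (pinnedChain ω₂ lam β γ).bondCurrent N i y)
            ∂((pinnedChain ω₂ lam β γ).transitionKernel N T T t.toNNReal x)) atTop (𝓝 (u x))) :
    MemLp u 2 (volume.withDensity fun x : PhaseSpace N =>
        ENNReal.ofReal (Real.exp (-((pinnedChain ω₂ lam β γ).hamiltonian N x) / T))) ∧
      ∫ x, (u x) ^ 2 ∂(volume.withDensity fun x : PhaseSpace N =>
          ENNReal.ofReal (Real.exp (-((pinnedChain ω₂ lam β γ).hamiltonian N x) / T)))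
        ≤ K * (N : ℝ) ^ 2 * ∫ x : PhaseSpace N, Real.exp (-((pinnedChain ω₂ lam β γ).hamiltonian N x) / T) := by
  have hu0 := corrector_ae_eq_zero_of_le_one hN u hu
  have hz : MemLp (0 : PhaseSpace N → ℝ) 2 (volume.withDensity fun x : PhaseSpace N =>
      ENNReal.ofReal (Real.exp (-((pinnedChain ω₂ lam β γ).hamiltonian N x) / T))) := MemLp.zero
  refine ⟨hz.ae_eq hu0.symm, ?_⟩
  have h1 : ∫ x, (u x) ^ 2 ∂(volume.withDensity fun x : PhaseSpace N =>
      ENNReal.ofReal (Real.exp (-((pinnedChain ω₂ lam β γ).hamiltonian N x) / T))) = 0 := by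
    have : (fun x => (u x) ^ 2) =ᵐ[volume.withDensity fun x : PhaseSpace N =>
        ENNReal.ofReal (Real.exp (-((pinnedChain ω₂ lam β γ).hamiltonian N x) / T))] fun _ => (0 : ℝ) := by
      filter_upwards [hu0] with x hx
      simp [hx]
    rw [integral_congr_ae this, integral_zero]
  rw [h1]
  have hZ : 0 ≤ ∫ x : PhaseSpace N, Real.exp (-((pinnedChain ω₂ lam β γ).hamiltonian N x) / T) :=
    integral_nonneg fun _ => (Real.exp_pos _).le
  positivity

/-- **The bookkeeping of the line, abstractly** (`v = W + E = (a + b)/2` with `a = W − W∘Θ`,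
`b = W + W∘Θ + 2E`; `u = n·v` a.e.; `(a+b)²/4 ≤ (a² + b²)/2` pointwise):
`u ∈ L²` and `∫u² = n²∫v² ≤ n²·½(∫a² + ∫b²) ≤ ½(K₁ + K₂)·m·Z` whenever `n² ≤ m`, `0 ≤ K₁, K₂, Z`. -/
theorem defect_glue {N : ℕ} {μ : Measure (PhaseSpace N)} {u W : PhaseSpace N → ℝ}
    (E : PhaseSpace N → ℝ) {n m K₁ K₂ Z : ℝ}
    (hsplit : ∀ᵐ x ∂μ, u x = n * (W x + E x))
    (ha : MemLp (fun x : PhaseSpace N => W x - W (x.1, -x.2)) 2 μ)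
    (hia : ∫ x, (W x - W (x.1, -x.2)) ^ 2 ∂μ ≤ K₁ * Z)
    (hb : MemLp (fun x : PhaseSpace N => W x + W (x.1, -x.2) + 2 * E x) 2 μ)
    (hib : ∫ x, (W x + W (x.1, -x.2) + 2 * E x) ^ 2 ∂μ ≤ K₂ * Z)
    (hK₁ : 0 ≤ K₁) (hK₂ : 0 ≤ K₂) (hZ : 0 ≤ Z) (hnm : n ^ 2 ≤ m) :
    MemLp u 2 μ ∧ ∫ x, (u x) ^ 2 ∂μ ≤ (K₁ + K₂) / 2 * m * Z := by
  -- v = (a + b)/2 is in L²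
  have hv2 : MemLp (fun x : PhaseSpace N => W x + E x) 2 μ := by
    refine MemLp.ae_eq ?_ ((ha.add hb).const_mul (1 / 2 : ℝ))
    filter_upwards with x
    simp only [Pi.add_apply]
    ring
  -- u = n · v a.e. is in L²
  have hu_ae : u =ᵐ[μ] fun x => n * (W x + E x) := hsplit
  have hu2 : MemLp u 2 μ := MemLp.ae_eq hu_ae.symm (hv2.const_mul n)
  refine ⟨hu2, ?_⟩
  -- ∫ u² = n² ∫ v²
  have hint : ∫ x, (u x) ^ 2 ∂μ = n ^ 2 * ∫ x, (W x + E x) ^ 2 ∂μ := by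
    rw [← integral_const_mul]
    refine integral_congr_ae ?_
    filter_upwards [hsplit] with x hx
    rw [hx]
    ring
  -- pointwise parallelogram bound and its integral
  have hpt : ∀ x : PhaseSpace N, (W x + E x) ^ 2 ≤
      ((W x - W (x.1, -x.2)) ^ 2 + (W x + W (x.1, -x.2) + 2 * E x) ^ 2) / 2 := by
    intro x
    nlinarith [sq_nonneg (W (x.1, -x.2) + E x)]
  have hmono : ∫ x, (W x + E x) ^ 2 ∂μ ≤
      ∫ x, ((W x - W (x.1, -x.2)) ^ 2 + (W x + W (x.1, -x.2) + 2 * E x) ^ 2) / 2 ∂μ :=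
    integral_mono hv2.integrable_sq ((ha.integrable_sq.add hb.integrable_sq).div_const 2) hpt
  have hsum : ∫ x, ((W x - W (x.1, -x.2)) ^ 2 + (W x + W (x.1, -x.2) + 2 * E x) ^ 2) / 2 ∂μ =
      ((∫ x, (W x - W (x.1, -x.2)) ^ 2 ∂μ) + ∫ x, (W x + W (x.1, -x.2) + 2 * E x) ^ 2 ∂μ) / 2 := by
    rw [integral_div, integral_add ha.integrable_sq hb.integrable_sq]
  have hv_le : ∫ x, (W x + E x) ^ 2 ∂μ ≤ (K₁ + K₂) / 2 * Z := by
    have h := hmono.trans_eq hsum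
    nlinarith [hia, hib, h]
  have hKZ : 0 ≤ (K₁ + K₂) / 2 * Z := by positivity
  calc ∫ x, (u x) ^ 2 ∂μ = n ^ 2 * ∫ x, (W x + E x) ^ 2 ∂μ := hint
    _ ≤ n ^ 2 * ((K₁ + K₂) / 2 * Z) := mul_le_mul_of_nonneg_left hv_le (sq_nonneg n)
    _ ≤ m * ((K₁ + K₂) / 2 * Z) := mul_le_mul_of_nonneg_right hnm hKZ
    _ = (K₁ + K₂) / 2 * m * Z := by ring

/-! ## The composition: the three stubs give the crux, BY NAME -/

/-- **The line = the crux proof skeleton.**  From the three registered stubs, the crux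
`ConeScaleCorrector` (stmt-AtomisticToContinuum-14069) BY NAME, with constant `C = ½(max C₁ 0 + max C₂ 0)`
(`C₁, C₂` the constants of the two N-uniform stubs).  The composition is complete (no `sorry` of its own:
`defect_glue` + `slice_le_one`); it becomes the crux proof when the three stub bodies are discharged. -/
theorem ConeScaleCorrector_of : ConeScaleCorrector := by
  -- the three registered stubs (the ONLY place `sorry` enters); to re-abstract the composition over the
  -- statements, turn these three `have`s into hypotheses — nothing below refers to the stubs otherwise
  have hS := stub_correctorSplitting
  have hO := stub_contactReversalAsymmetry
  have hE := stub_evenForecastLocalEquilibrium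
  intro ω₂ lam β γ hω hl hβ hγ T hT
  obtain ⟨C₁, hC₁⟩ := hO ω₂ lam β γ hω hl hβ hγ T hT
  obtain ⟨C₂, hC₂⟩ := hE ω₂ lam β γ hω hl hβ hγ T hT
  refine ⟨(max C₁ 0 + max C₂ 0) / 2, fun N u => ?_⟩
  dsimp only
  intro hu
  rcases Nat.lt_or_ge N 2 with hN | hN
  · -- N ≤ 1: no bond, u = 0 a.e.
    exact slice_le_one (by omega) (by positivity) u hu
  · -- N ≥ 2: splitting + the two parity halves
    obtain ⟨W, hW2, hWlim, hsplit⟩ := hS ω₂ lam β γ hω hl hβ hγ T hT N hN u hu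
    obtain ⟨ha, hia⟩ := hC₁ N hN W hW2 hWlim
    obtain ⟨hb, hib⟩ := hC₂ N hN W hW2 hWlim
    have hZ : 0 ≤ ∫ x : PhaseSpace N, Real.exp (-((pinnedChain ω₂ lam β γ).hamiltonian N x) / T) :=
      integral_nonneg fun _ => (Real.exp_pos _).le
    have hnm : ((N : ℝ) - 1) ^ 2 ≤ (N : ℝ) ^ 2 := by
      have h1 : (1 : ℝ) ≤ N := by exact_mod_cast (show 1 ≤ N by omega)
      nlinarith
    exact defect_glue _ hsplit ha (hia.trans (mul_le_mul_of_nonneg_right (le_max_left C₁ 0) hZ))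
      hb (hib.trans (mul_le_mul_of_nonneg_right (le_max_left C₂ 0) hZ))
      (le_max_right C₁ 0) (le_max_right C₂ 0) hZ hnm

/-! ## For the tenure planner: the ODD HALF of E1 needs only stubs 1 + 2

Three triage seats record that the route's `closes` consumes E1 only through `‖u⁻‖ ≤ ‖u‖`, so the crux
could be weakened to its odd half WSI′ `∫ (u − u∘Θ)² dμ_T ≤ C·N²·Z`.  The theorem below certifies that
THIS line then shrinks to TWO stubs: `stub_correctorSplitting` + `stub_contactReversalAsymmetry` give WSI′
(in the crux's raw vocabulary, with `C = max C₁ 0`), kernel-checked; `stub_evenForecastLocalEquilibrium`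
is needed only for E1 as typed.  (Not an obligation of any route today — documentation of the cut.) -/

/-- **Odd half of E1 from stubs 1 + 2**: for all parameters `> 0`, `T > 0` there is `C` with, for every
`N` and every `u` satisfying the crux's corrector predicate, `u − u∘Θ ∈ L²(μ_T)` and
`∫ (u(x) − u(Θx))² dμ_T ≤ C·N²·Z`.  Proof: `Ẽ_L∘Θ = Ẽ_L` (`leftWeightedEnergy_momentumReversal`) and
the a.e. identity of stub 1 transported along `Θ` (`ae_comp_momentumReversal`) give
`u − u∘Θ = (N−1)(W − W∘Θ)` a.e.; then stub 2. -/
theorem oddHalf_of_line :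
    ∀ ω₂ lam β γ : ℝ, 0 < ω₂ → 0 < lam → 0 < β → 0 < γ → ∀ T : ℝ, 0 < T → ∃ C : ℝ,
    ∀ (N : ℕ) (u : PhaseSpace N → ℝ),
    (∀ᵐ x ∂(volume.withDensity fun x : PhaseSpace N =>
        ENNReal.ofReal (Real.exp (-((pinnedChain ω₂ lam β γ).hamiltonian N x) / T))),
      Tendsto (fun τ : ℝ => ∫ t in Set.Ioc (0 : ℝ) τ,
          ∫ y, (∑ i : Fin N, (pinnedChain ω₂ lam β γ).bondCurrent N i y)
            ∂((pinnedChain ω₂ lam β γ).transitionKernel N T T t.toNNReal x)) atTop (𝓝 (u x))) →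
    MemLp (fun x : PhaseSpace N => u x - u (x.1, -x.2)) 2 (volume.withDensity fun x : PhaseSpace N =>
        ENNReal.ofReal (Real.exp (-((pinnedChain ω₂ lam β γ).hamiltonian N x) / T))) ∧
    ∫ x, (u x - u (x.1, -x.2)) ^ 2 ∂(volume.withDensity fun x : PhaseSpace N =>
        ENNReal.ofReal (Real.exp (-((pinnedChain ω₂ lam β γ).hamiltonian N x) / T)))
      ≤ C * (N : ℝ) ^ 2 * ∫ x : PhaseSpace N, Real.exp (-((pinnedChain ω₂ lam β γ).hamiltonian N x) / T) := by
  have hS := stub_correctorSplitting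
  have hO := stub_contactReversalAsymmetry
  intro ω₂ lam β γ hω hl hβ hγ T hT
  obtain ⟨C₁, hC₁⟩ := hO ω₂ lam β γ hω hl hβ hγ T hT
  refine ⟨max C₁ 0, fun N u hu => ?_⟩
  set μ : Measure (PhaseSpace N) := volume.withDensity fun x : PhaseSpace N =>
    ENNReal.ofReal (Real.exp (-((pinnedChain ω₂ lam β γ).hamiltonian N x) / T)) with hμ
  set Z : ℝ := ∫ x : PhaseSpace N, Real.exp (-((pinnedChain ω₂ lam β γ).hamiltonian N x) / T) with hZdef
  have hZ : 0 ≤ Z := integral_nonneg fun _ => (Real.exp_pos _).le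
  have hz : MemLp (0 : PhaseSpace N → ℝ) 2 μ := MemLp.zero
  rcases Nat.lt_or_ge N 2 with hN | hN
  · -- N ≤ 1: u = 0 a.e., hence also u∘Θ = 0 a.e.
    have hu0 : u =ᵐ[μ] 0 := corrector_ae_eq_zero_of_le_one (by omega) u hu
    have hu0' := ae_comp_momentumReversal hu0
    have hd : (fun x : PhaseSpace N => u x - u (x.1, -x.2)) =ᵐ[μ] 0 := by
      filter_upwards [hu0, hu0'] with x h1 h2
      simp only [Pi.zero_apply] at h1 h2 ⊢
      rw [h1, h2, sub_zero]
    refine ⟨hz.ae_eq hd.symm, ?_⟩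
    have h1 : ∫ x, (u x - u (x.1, -x.2)) ^ 2 ∂μ = 0 := by
      have : (fun x : PhaseSpace N => (u x - u (x.1, -x.2)) ^ 2) =ᵐ[μ] fun _ => (0 : ℝ) := by
        filter_upwards [hd] with x hx
        simp only [Pi.zero_apply] at hx
        simp [hx]
      rw [integral_congr_ae this, integral_zero]
    rw [h1]
    positivity
  · -- N ≥ 2: splitting, transported along Θ, evenness of E_L, then the odd stub
    obtain ⟨W, hW2, hWlim, hsplit⟩ := hS ω₂ lam β γ hω hl hβ hγ T hT N hN u hu
    obtain ⟨ha, hia⟩ := hC₁ N hN W hW2 hWlim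
    have hsplit' := ae_comp_momentumReversal hsplit
    have hdiff : ∀ᵐ x ∂μ, u x - u (x.1, -x.2) = ((N : ℝ) - 1) * (W x - W (x.1, -x.2)) := by
      filter_upwards [hsplit, hsplit'] with x h1 h2
      rw [h1, h2, leftWeightedEnergy_momentumReversal]
      ring
    have hmem : MemLp (fun x : PhaseSpace N => u x - u (x.1, -x.2)) 2 μ :=
      MemLp.ae_eq (hdiff.mono fun x hx => hx.symm) (ha.const_mul ((N : ℝ) - 1))
    have hint : ∫ x, (u x - u (x.1, -x.2)) ^ 2 ∂μ =
        ((N : ℝ) - 1) ^ 2 * ∫ x, (W x - W (x.1, -x.2)) ^ 2 ∂μ := by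
      rw [← integral_const_mul]
      refine integral_congr_ae ?_
      filter_upwards [hdiff] with x hx
      rw [hx]
      ring
    have hnm : ((N : ℝ) - 1) ^ 2 ≤ (N : ℝ) ^ 2 := by
      have h1 : (1 : ℝ) ≤ N := by exact_mod_cast (show 1 ≤ N by omega)
      nlinarith
    refine ⟨hmem, ?_⟩
    calc ∫ x, (u x - u (x.1, -x.2)) ^ 2 ∂μ
        = ((N : ℝ) - 1) ^ 2 * ∫ x, (W x - W (x.1, -x.2)) ^ 2 ∂μ := hint
      _ ≤ ((N : ℝ) - 1) ^ 2 * (max C₁ 0 * Z) :=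
          mul_le_mul_of_nonneg_left (hia.trans (mul_le_mul_of_nonneg_right (le_max_left C₁ 0) hZ))
            (sq_nonneg _)
      _ ≤ (N : ℝ) ^ 2 * (max C₁ 0 * Z) :=
          mul_le_mul_of_nonneg_right hnm (mul_nonneg (le_max_right C₁ 0) hZ)
      _ = max C₁ 0 * (N : ℝ) ^ 2 * Z := by ring

end

end Summit.AtomisticToContinuum.FouriersLaw.Cruxes.ConeScaleCorrector.GamblersRuinDefect
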